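import Mathlib
import Summits.ResolutionOfSingularities.ResolutionOfSingularities.Theorems.FrobeniusClosingSteerRadicandChainRealisationLayerOne
import Summits.ResolutionOfSingularities.ResolutionOfSingularities.Theorems.FrobeniusClosingSteerNoEternalChainOne
import HarnessLib

/-!
# Crux `Steer` (stmt-ResolutionOfSingularities-16345), chain W4.1, R2 σ_top line: **K(2) realisation layer,
# the quadratic transform law** — `R (m+1)` is a quadratic transform of `R m` inside `K′`

OURS (campaign `res-hironaka`, rung L ★L-G4, slot W4.1; seat `res-L1-type-o8` = `res-D-pv-015`; SPLIT of
res-L0-w41-plan-1's ORDER 05:10:18Z, realisation half, agreed with the K(2) holder res-type-026 05:29:44Z).  Not a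
statement of the manuscript under review; AI review is weaker than expert review.

For the realised members `R m = realR hθ m = S m[θ m] ⊆ K′` (`…RealisationTower`): if `S (m+1)` is a quadratic
transform of `S m` along `x' ∈ 𝔪_m` (Cutkosky §2.1: `S (m+1) ⊇ S m[𝔪_m/x']`, fractions with unit denominators,
domination) with `𝔪_m S (m+1) = (x m)` and `f m ≡ (g m)^p (mod 𝔪_m)`, then `R (m+1)` is a quadratic transform
of `R m` along `x'`: the maximal ideal of `R m` is `(θ m − g m) + 𝔪_m R m` (`…RealisationBase`), and
`(θ m − g m)/x' = (x m / x') · θ (m+1)`, `y / x' ∈ S (m+1)` (`y ∈ 𝔪_m`) give `R m[𝔑_m/x'] ⊆ R (m+1) =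
S (m+1)[θ (m+1)]`; every element of `S (m+1)` and `θ (m+1) = ((θ m − g m)/x') · (x'/x m)` is a fraction over
`R m[𝔑_m/x']` with denominator a unit of `R (m+1)`; and `𝔑_m ⊆ 𝔑_{m+1}` (domination).
Main: `isQuadraticTransform_realR`. [cite: Cutkosky2014, §2.1] [folklore]
-/

noncomputable section

-- `Summit.<S>.<S>.…` duplicates the summit name by design (single-problem summit).
set_option linter.dupNamespace false

open Polynomial IsLocalRing

namespace Summit.ResolutionOfSingularities.ResolutionOfSingularities.Theorems.SwitchingDichotomy

namespace RadicandChainRealisation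

open Literature.AlgebraicGeometry.Resolution

universe u

/-! ## (0) The subring of fractions with prescribed denominators -/

section Frac

variable {K : Type*} [Field K]

/-- The fractions `a / b` with `a, b ∈ B`, `b ≠ 0` and `b⁻¹ ∈ R'` form a subring of `K`.  OURS. [folklore] -/
def fracSubring (B R' : Subring K) : Subring K where
  carrier := {z | ∃ a ∈ B, ∃ b ∈ B, b ≠ 0 ∧ b⁻¹ ∈ R' ∧ z = a / b}
  mul_mem' := by
    rintro z w ⟨a, ha, b, hb, hb0, hbi, rfl⟩ ⟨c, hc, d, hd, hd0, hdi, rfl⟩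
    refine ⟨a * c, B.mul_mem ha hc, b * d, B.mul_mem hb hd, mul_ne_zero hb0 hd0, ?_, ?_⟩
    · rw [mul_inv]; exact R'.mul_mem hbi hdi
    · rw [div_mul_div_comm]
  one_mem' := ⟨1, B.one_mem, 1, B.one_mem, one_ne_zero, by rw [inv_one]; exact R'.one_mem, by rw [div_one]⟩
  add_mem' := by
    rintro z w ⟨a, ha, b, hb, hb0, hbi, rfl⟩ ⟨c, hc, d, hd, hd0, hdi, rfl⟩
    refine ⟨a * d + b * c, B.add_mem (B.mul_mem ha hd) (B.mul_mem hb hc), b * d, B.mul_mem hb hd,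
      mul_ne_zero hb0 hd0, ?_, ?_⟩
    · rw [mul_inv]; exact R'.mul_mem hbi hdi
    · rw [div_add_div _ _ hb0 hd0]
  zero_mem' := ⟨0, B.zero_mem, 1, B.one_mem, one_ne_zero, by rw [inv_one]; exact R'.one_mem, by rw [zero_div]⟩
  neg_mem' := by
    rintro z ⟨a, ha, b, hb, hb0, hbi, rfl⟩
    exact ⟨-a, B.neg_mem ha, b, hb, hb0, hbi, by rw [neg_div]⟩

/-- Membership in `fracSubring`. [folklore] -/
theorem mem_fracSubring_iff {B R' : Subring K} {z : K} :
    z ∈ fracSubring B R' ↔ ∃ a ∈ B, ∃ b ∈ B, b ≠ 0 ∧ b⁻¹ ∈ R' ∧ z = a / b := Iff.rfl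

/-- `B ≤ fracSubring B R'`. [folklore] -/
theorem le_fracSubring (B R' : Subring K) : B ≤ fracSubring B R' := fun z hz =>
  ⟨z, hz, 1, B.one_mem, one_ne_zero, by rw [inv_one]; exact R'.one_mem, by rw [div_one]⟩

end Frac

/-! ## (1) Chain-level facts in `S m ⊆ S (m+1)` -/

section Chain

variable {L : Type u} [Field L] {S₀ S₁ : Subring L} [IsLocalRing S₀] [IsLocalRing S₁] (hle : S₀ ≤ S₁)

/-- Along a dominating extension, an element of `S₀` which is a non-unit in `S₁` is a non-unit in `S₀`… and
conversely elements of `𝔪_{S₀}` stay in `𝔪_{S₁}` (`NoEternalChainOne.inclusion_mem_maximalIdeal_of_subringDominates`);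
here: an element of `S₀` lying in `𝔪_{S₁}` lies in `𝔪_{S₀}`. [folklore] -/
theorem mem_maximalIdeal_of_inclusion_mem {y : S₀} (hy : (⟨(y : L), hle y.2⟩ : S₁) ∈ maximalIdeal S₁) :
    y ∈ maximalIdeal S₀ := by
  rw [mem_maximalIdeal_iff_inv_not_mem] at hy ⊢
  rcases hy with hy | hy
  · exact Or.inl hy
  · exact Or.inr fun h => hy (hle h)

omit [IsLocalRing S₁] in
/-- If `S₁ ⊇ S₀[𝔪₀/x']` then `𝔪₀ S₁ ⊆ x' S₁`. [folklore] -/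
theorem span_image_le_span_singleton {x' : S₀} (hbl : blowupRing S₀ (x' : L) ≤ S₁) (hx'0 : (x' : L) ≠ 0) :
    Ideal.span ((fun y : S₀ => (⟨(y : L), hle y.2⟩ : S₁)) '' (maximalIdeal S₀ : Set S₀)) ≤
      Ideal.span {(⟨(x' : L), hle x'.2⟩ : S₁)} := by
  refine Ideal.span_le.mpr ?_
  rintro _ ⟨y, hy, rfl⟩
  refine Ideal.mem_span_singleton'.mpr ⟨⟨(y : L) / x', hbl (div_mem_blowupRing _ hy)⟩, Subtype.ext ?_⟩
  simp [div_mul_cancel₀ _ hx'0]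

omit [IsLocalRing S₁] in
/-- **The exceptional parameters differ by a unit**: if `𝔪₀ S₁ = (x₁)` and `S₁ ⊇ S₀[𝔪₀/x']` with `0 ≠ x' ∈ 𝔪₀`,
then `x₁ = s' x'` and `x' = s'' x₁` with `s' s'' = 1`. [folklore] -/
theorem exists_unit_ratio {x' : S₀} (hx'𝔪 : x' ∈ maximalIdeal S₀) (hx'0 : (x' : L) ≠ 0)
    (hbl : blowupRing S₀ (x' : L) ≤ S₁) {x₁ : S₁}
    (hspan : Ideal.span ((fun y : S₀ => (⟨(y : L), hle y.2⟩ : S₁)) '' (maximalIdeal S₀ : Set S₀)) =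
      Ideal.span {x₁}) :
    ∃ s' s'' : S₁, (x₁ : L) = s' * x' ∧ (x' : L) = s'' * x₁ ∧ s' * s'' = 1 ∧ (x₁ : L) ≠ 0 := by
  have h1 : x₁ ∈ Ideal.span {(⟨(x' : L), hle x'.2⟩ : S₁)} :=
    span_image_le_span_singleton hle hbl hx'0 (hspan ▸ Ideal.mem_span_singleton_self x₁)
  obtain ⟨s', hs'⟩ := Ideal.mem_span_singleton'.mp h1
  have h2 : (⟨(x' : L), hle x'.2⟩ : S₁) ∈ Ideal.span {x₁} :=
    hspan ▸ Ideal.subset_span ⟨x', hx'𝔪, rfl⟩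
  obtain ⟨s'', hs''⟩ := Ideal.mem_span_singleton'.mp h2
  have hx₁ : (x₁ : L) = s' * x' := by
    have := congrArg (fun z : S₁ => (z : L)) hs'; simpa using this.symm
  have hx' : (x' : L) = s'' * x₁ := by
    have := congrArg (fun z : S₁ => (z : L)) hs''; simpa using this.symm
  have hx₁0 : (x₁ : L) ≠ 0 := by
    intro h0; apply hx'0; rw [hx', h0, mul_zero]
  refine ⟨s', s'', hx₁, hx', Subtype.ext ?_, hx₁0⟩
  have : (s' : L) * s'' * x₁ = x₁ := by
    conv_rhs => rw [hx₁, hx']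
    ring
  have := mul_right_cancel₀ hx₁0 (this.trans (one_mul _).symm)
  simpa using this

end Chain

/-! ## (2) The quadratic transform law for the realised members -/

section QT

variable (p : ℕ) [hp : Fact p.Prime] {L : Type u} [Field L] (S : ℕ → Subring L)
variable [∀ m, IsLocalRing (S m)] (f : ∀ m, S m)
variable [Fact (Irreducible (radPoly p S f))] (g : ∀ m, S m) (x : ∀ m, S (m + 1))
variable (hθ : ∀ m, theta p S f g x m ^ p = emb p S f m (f m))

/-- **The maximal ideal of `R m`** is `(θ m − g m) + 𝔪_m R m` (transport of `maximalIdeal_adjoinRoot_eq`).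
[folklore] -/
theorem maximalIdeal_realR_eq [CharP L p] (m : ℕ) (hinj : Function.Injective (phi p S f g x hθ m))
    (hfg : f m - g m ^ p ∈ maximalIdeal (S m)) [IsLocalRing (AdjoinRoot ((X : (S m)[X]) ^ p - C (f m)))]
    [IsLocalRing (realR p S f g x hθ m)] :
    maximalIdeal (realR p S f g x hθ m) =
      Ideal.span {equivRealR p S f g x hθ m hinj (AdjoinRoot.root _ - AdjoinRoot.of _ (g m))} ⊔
        ((maximalIdeal (S m)).map (AdjoinRoot.of ((X : (S m)[X]) ^ p - C (f m)))).map
          (equivRealR p S f g x hθ m hinj) := by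
  rw [← map_ringEquiv_maximalIdeal (equivRealR p S f g x hθ m hinj), maximalIdeal_adjoinRoot_eq (f m) (g m) hfg,
    Ideal.map_sup, Ideal.map_span, Set.image_singleton]

/-- Elements of `𝔪_m` give elements of the maximal ideal of `R m`. [folklore] -/
theorem emb_mem_maximalIdeal_realR (m : ℕ) (hinj : Function.Injective (phi p S f g x hθ m))
    [IsLocalRing (AdjoinRoot ((X : (S m)[X]) ^ p - C (f m)))] [IsLocalRing (realR p S f g x hθ m)]
    {s : S m} (hs : s ∈ maximalIdeal (S m)) :
    (⟨emb p S f m s, emb_mem_realR p S f g x hθ m s⟩ : realR p S f g x hθ m) ∈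
      maximalIdeal (realR p S f g x hθ m) := by
  rw [← map_ringEquiv_maximalIdeal (equivRealR p S f g x hθ m hinj)]
  have : (⟨emb p S f m s, emb_mem_realR p S f g x hθ m s⟩ : realR p S f g x hθ m) =
      equivRealR p S f g x hθ m hinj (AdjoinRoot.of _ s) := Subtype.ext (by simp)
  rw [this]
  exact Ideal.mem_map_of_mem _ (of_mem_maximalIdeal (f m) hs)

/-- `θ m − g m` lies in the maximal ideal of `R m`. [folklore] -/
theorem theta_sub_mem_maximalIdeal_realR [CharP L p] (m : ℕ) (hinj : Function.Injective (phi p S f g x hθ m))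
    (hfg : f m - g m ^ p ∈ maximalIdeal (S m)) [IsLocalRing (AdjoinRoot ((X : (S m)[X]) ^ p - C (f m)))]
    [IsLocalRing (realR p S f g x hθ m)] :
    (⟨theta p S f g x m - emb p S f m (g m), sub_mem (theta_mem_realR p S f g x hθ m)
      (emb_mem_realR p S f g x hθ m (g m))⟩ : realR p S f g x hθ m) ∈ maximalIdeal (realR p S f g x hθ m) := by
  have : (⟨theta p S f g x m - emb p S f m (g m), sub_mem (theta_mem_realR p S f g x hθ m)
      (emb_mem_realR p S f g x hθ m (g m))⟩ : realR p S f g x hθ m) =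
      equivRealR p S f g x hθ m hinj (AdjoinRoot.root _ - AdjoinRoot.of _ (g m)) := Subtype.ext (by simp)
  rw [this, maximalIdeal_realR_eq p S f g x hθ m hinj hfg]
  exact Ideal.mem_sup_left (Ideal.mem_span_singleton_self _)

/-- An ideal of `R m` containing `θ m − g m` and `𝔪_m` contains the maximal ideal. [folklore] -/
theorem maximalIdeal_realR_le [CharP L p] (m : ℕ) (hinj : Function.Injective (phi p S f g x hθ m))
    (hfg : f m - g m ^ p ∈ maximalIdeal (S m)) [IsLocalRing (AdjoinRoot ((X : (S m)[X]) ^ p - C (f m)))]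
    [IsLocalRing (realR p S f g x hθ m)] {J : Ideal (realR p S f g x hθ m)}
    (h1 : (⟨theta p S f g x m - emb p S f m (g m), sub_mem (theta_mem_realR p S f g x hθ m)
      (emb_mem_realR p S f g x hθ m (g m))⟩ : realR p S f g x hθ m) ∈ J)
    (h2 : ∀ s ∈ maximalIdeal (S m), (⟨emb p S f m s, emb_mem_realR p S f g x hθ m s⟩ : realR p S f g x hθ m) ∈ J) :
    maximalIdeal (realR p S f g x hθ m) ≤ J := by
  rw [maximalIdeal_realR_eq p S f g x hθ m hinj hfg]
  refine sup_le ?_ ?_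
  · rw [Ideal.span_le, Set.singleton_subset_iff]
    have : equivRealR p S f g x hθ m hinj (AdjoinRoot.root _ - AdjoinRoot.of _ (g m)) =
        (⟨theta p S f g x m - emb p S f m (g m), sub_mem (theta_mem_realR p S f g x hθ m)
          (emb_mem_realR p S f g x hθ m (g m))⟩ : realR p S f g x hθ m) := Subtype.ext (by simp)
    rw [SetLike.mem_coe, this]; exact h1
  · rw [Ideal.map_le_iff_le_comap, Ideal.map_le_iff_le_comap]
    intro s hs
    have : equivRealR p S f g x hθ m hinj (AdjoinRoot.of ((X : (S m)[X]) ^ p - C (f m)) s) =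
        (⟨emb p S f m s, emb_mem_realR p S f g x hθ m s⟩ : realR p S f g x hθ m) := Subtype.ext (by simp)
    rw [Ideal.mem_comap, Ideal.mem_comap, this]
    exact h2 s hs

omit hp [∀ m, IsLocalRing (S m)] in
/-- `y / x' ↦ emb_m y / emb x'`: the embedding of a blow-up quotient. [folklore] -/
theorem emb_div_eq (hle : ∀ m, S m ≤ S (m + 1)) (m : ℕ) {x' : S m} (hx'0 : (x' : L) ≠ 0) {y : S m}
    (hy : ((y : L) / x') ∈ S (m + 1)) :
    emb p S f (m + 1) ⟨(y : L) / x', hy⟩ = emb p S f m y / emb p S f m x' := by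
  have hξ0 : emb p S f m x' ≠ 0 := fun h0 => hx'0 (by
    have := emb_injective p S f m (h0.trans (map_zero _).symm); simp [this])
  rw [eq_div_iff hξ0, emb_eq_of_coe_eq p S f (s := x') (t := ⟨(x' : L), hle m x'.2⟩) rfl, ← map_mul]
  exact emb_eq_of_coe_eq p S f (by simp [div_mul_cancel₀ _ hx'0])

/-- **Image of the blow-up ring**: `emb (S m[𝔪_m/x']) ⊆ R m[𝔑_m/x']`. [folklore] -/
theorem emb_mem_blowupRing_of_mem (hle : ∀ m, S m ≤ S (m + 1)) (m : ℕ)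
    (hinj : Function.Injective (phi p S f g x hθ m))
    [IsLocalRing (AdjoinRoot ((X : (S m)[X]) ^ p - C (f m)))] [IsLocalRing (realR p S f g x hθ m)]
    {x' : S m} (hx'0 : (x' : L) ≠ 0) (hbl : blowupRing (S m) (x' : L) ≤ S (m + 1))
    {a : L} (ha : a ∈ blowupRing (S m) (x' : L)) :
    emb p S f (m + 1) ⟨a, hbl ha⟩ ∈ blowupRing (realR p S f g x hθ m) (emb p S f m x') := by
  unfold blowupRing at ha hbl
  induction ha using Subring.closure_induction with
  | mem a h =>
    rcases h with h | ⟨y, hy, rfl⟩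
    · convert le_blowupRing _ _ (emb_mem_realR p S f g x hθ m ⟨a, h⟩) using 1
      exact emb_eq_of_coe_eq p S f rfl
    · convert div_mem_blowupRing (R := realR p S f g x hθ m) _
        (emb_mem_maximalIdeal_realR p S f g x hθ m hinj hy) using 1
      exact emb_div_eq p S f hle m hx'0 _
  | zero =>
    change emb p S f (m + 1) (0 : S (m + 1)) ∈ _
    rw [map_zero]; exact Subring.zero_mem _
  | one =>
    change emb p S f (m + 1) (1 : S (m + 1)) ∈ _
    rw [map_one]; exact Subring.one_mem _
  | add a b ha hb iha ihb =>
    have : (⟨a + b, hbl (add_mem ha hb)⟩ : S (m + 1)) = ⟨a, hbl ha⟩ + ⟨b, hbl hb⟩ := rfl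
    rw [this, map_add]; exact add_mem iha ihb
  | neg a ha iha =>
    have : (⟨-a, hbl (neg_mem ha)⟩ : S (m + 1)) = -⟨a, hbl ha⟩ := rfl
    rw [this, map_neg]; exact neg_mem iha
  | mul a b ha hb iha ihb =>
    have : (⟨a * b, hbl (mul_mem ha hb)⟩ : S (m + 1)) = ⟨a, hbl ha⟩ * ⟨b, hbl hb⟩ := rfl
    rw [this, map_mul]; exact mul_mem iha ihb

/-- **`R (m+1)` is a quadratic transform of `R m`** along `x'`, the parameter of the quadratic transform
`S m → S (m+1)`. [cite: Cutkosky2014, §2.1] [folklore] -/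
theorem isQuadraticTransform_realR [CharP L p] (hle : ∀ m, S m ≤ S (m + 1)) (hx0 : ∀ m, (x m : L) ≠ 0) (m : ℕ)
    (hinj : ∀ m, Function.Injective (phi p S f g x hθ m))
    (hmult : ∀ m, ∃ h : S m, f m - h ^ p ∈ maximalIdeal (S m) ^ p)
    (hQT : IsQuadraticTransform (S m) (S (m + 1)))
    (hspan : Ideal.span ((fun y : S m => (⟨(y : L), hle m y.2⟩ : S (m + 1))) ''
        (maximalIdeal (S m) : Set (S m))) = Ideal.span {x m})
    (hrel : ((f (m + 1) : S (m + 1)) : L) * ((x m : S (m + 1)) : L) ^ p =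
      ((f m : S m) : L) - ((g m : S m) : L) ^ p) :
    IsQuadraticTransform (realR p S f g x hθ m) (realR p S f g x hθ (m + 1)) := by
  obtain ⟨_, x', hx'𝔪, hx'0, _, hbl, hfrac, hdom⟩ := hQT
  have hx'0L : (x' : L) ≠ 0 := fun e => hx'0 (Subtype.ext e)
  haveI := fun m => isLocalRing_adjoinRoot_member p S f m (hmult m)
  haveI := fun m => isLocalRing_realR p S f g x hθ m (hinj m) (hmult m)
  obtain ⟨s', s'', hxs', -, hss, -⟩ := exists_unit_ratio (hle m) hx'𝔪 hx'0L hbl hspan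
  -- `x m ∈ 𝔪_{m+1}` and `f m − (g m)^p ∈ 𝔪_m`
  have hxm𝔪 : x m ∈ maximalIdeal (S (m + 1)) := by
    have : x m ∈ Ideal.span {x m} := Ideal.mem_span_singleton_self _
    rw [← hspan] at this
    refine (Ideal.span_le.mpr ?_) this
    rintro _ ⟨y, hy, rfl⟩
    exact NoEternalChainOne.inclusion_mem_maximalIdeal_of_subringDominates hdom hy
  have hfg : f m - g m ^ p ∈ maximalIdeal (S m) := by
    apply mem_maximalIdeal_of_inclusion_mem (hle m)
    have : (⟨((f m - g m ^ p : S m) : L), hle m (f m - g m ^ p).2⟩ : S (m + 1)) = f (m + 1) * x m ^ p :=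
      Subtype.ext (by push_cast; exact (hrel).symm)
    rw [this]
    exact Ideal.mul_mem_left _ _ (Ideal.pow_mem_of_mem _ hxm𝔪 _ hp.out.pos)
  -- the parameter, seen in `R m`
  set ξ : realR p S f g x hθ m := ⟨emb p S f m x', emb_mem_realR p S f g x hθ m x'⟩ with hξ
  have hξ𝔪 : ξ ∈ maximalIdeal (realR p S f g x hθ m) := emb_mem_maximalIdeal_realR p S f g x hθ m (hinj m) hx'𝔪
  have hξ0 : (ξ : AdjoinRoot (radPoly p S f)) ≠ 0 := fun h0 => hx'0L (by
    have := emb_injective p S f m (h0.trans (map_zero _).symm); simp [this])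
  have hξ' : (ξ : AdjoinRoot (radPoly p S f)) = emb p S f (m + 1) ⟨(x' : L), hle m x'.2⟩ :=
    emb_eq_of_coe_eq p S f rfl
  have hRR : realR p S f g x hθ m ≤ realR p S f g x hθ (m + 1) := realR_le_succ p S f g x hθ hle hx0 m
  -- `θ m − g m = emb (x m) · θ (m+1)`, `emb (x m) = emb s' · ξ`, so `(θ m − g m)/ξ = emb s' · θ (m+1)`
  have hxm_eq : emb p S f (m + 1) (x m) =
      emb p S f (m + 1) s' * (ξ : AdjoinRoot (radPoly p S f)) := by
    rw [hξ', ← map_mul]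
    exact emb_eq_of_coe_eq p S f (by simp [hxs'])
  have hθsub : theta p S f g x m - emb p S f m (g m) =
      emb p S f (m + 1) (x m) * theta p S f g x (m + 1) := by
    rw [theta_eq_succ p S f g x hx0 m]; ring
  have hθdiv : (theta p S f g x m - emb p S f m (g m)) / (ξ : AdjoinRoot (radPoly p S f)) =
      emb p S f (m + 1) s' * theta p S f g x (m + 1) := by
    rw [hθsub, hxm_eq, mul_assoc, mul_comm (ξ : AdjoinRoot (radPoly p S f)), ← mul_assoc,
      mul_div_cancel_right₀ _ hξ0]
  -- (a) `R m[𝔑_m/ξ] ⊆ R (m+1)`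
  have hBl : blowupRing (realR p S f g x hθ m) (ξ : AdjoinRoot (radPoly p S f)) ≤
      realR p S f g x hθ (m + 1) := by
    let J : Ideal (realR p S f g x hθ m) :=
      { carrier := {y | (y : AdjoinRoot (radPoly p S f)) / ξ ∈ realR p S f g x hθ (m + 1)}
        add_mem' := fun {a b} ha hb => by
          simp only [Set.mem_setOf_eq, Subring.coe_add, add_div] at ha hb ⊢
          exact add_mem ha hb
        zero_mem' := by
          simp only [Set.mem_setOf_eq, ZeroMemClass.coe_zero, zero_div]
          exact zero_mem _
        smul_mem' := fun c {y} hy => by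
          simp only [Set.mem_setOf_eq, smul_eq_mul, Subring.coe_mul, mul_div_assoc] at hy ⊢
          exact mul_mem (hRR c.2) hy }
    have hJ : maximalIdeal (realR p S f g x hθ m) ≤ J := by
      refine maximalIdeal_realR_le p S f g x hθ m (hinj m) hfg ?_ ?_
      · show (theta p S f g x m - emb p S f m (g m)) / (ξ : AdjoinRoot (radPoly p S f)) ∈
          realR p S f g x hθ (m + 1)
        rw [hθdiv]
        exact mul_mem (emb_mem_realR p S f g x hθ (m + 1) s') (theta_mem_realR p S f g x hθ (m + 1))
      · intro s hs
        show emb p S f m s / (ξ : AdjoinRoot (radPoly p S f)) ∈ realR p S f g x hθ (m + 1)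
        rw [← emb_div_eq p S f hle m hx'0L (hbl (div_mem_blowupRing _ hs))]
        exact emb_mem_realR p S f g x hθ (m + 1) _
    unfold blowupRing
    refine Subring.closure_le.mpr ?_
    rintro z (hz | ⟨y, hy, rfl⟩)
    · exact hRR hz
    · exact hJ hy
  -- (b) every element of `R (m+1)` is a fraction over `R m[𝔑_m/ξ]` with denominator a unit of `R (m+1)`
  have hS : ∀ s : S (m + 1), emb p S f (m + 1) s ∈
      fracSubring (blowupRing (realR p S f g x hθ m) (ξ : AdjoinRoot (radPoly p S f))) (realR p S f g x hθ (m + 1)) := by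
    intro s
    obtain ⟨a, ha, b, hb, hbi, hs⟩ := hfrac (s : L) s.2
    by_cases hb0 : b = 0
    · have : s = 0 := Subtype.ext (by rw [hs, hb0, div_zero]; rfl)
      rw [this, map_zero]; exact zero_mem _
    have hb0' : emb p S f (m + 1) ⟨b, hbl hb⟩ ≠ 0 := fun h0 => hb0 (by
      have := emb_injective p S f (m + 1) (h0.trans (map_zero _).symm)
      simpa using congrArg Subtype.val this)
    refine ⟨emb p S f (m + 1) ⟨a, hbl ha⟩, emb_mem_blowupRing_of_mem p S f g x hθ hle m (hinj m) hx'0L hbl ha,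
      emb p S f (m + 1) ⟨b, hbl hb⟩, emb_mem_blowupRing_of_mem p S f g x hθ hle m (hinj m) hx'0L hbl hb,
      hb0', ?_, ?_⟩
    · have : (emb p S f (m + 1) ⟨b, hbl hb⟩)⁻¹ = emb p S f (m + 1) ⟨b⁻¹, hbi⟩ := by
        symm
        apply eq_inv_of_mul_eq_one_left
        rw [← map_mul, ← map_one (emb p S f (m + 1))]
        exact congrArg _ (Subtype.ext (by simp [inv_mul_cancel₀ hb0]))
      rw [this]
      exact emb_mem_realR p S f g x hθ (m + 1) _
    · rw [eq_div_iff hb0', ← map_mul]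
      exact congrArg _ (Subtype.ext (by simp [hs, div_mul_cancel₀ _ hb0]))
  have hθ' : theta p S f g x (m + 1) ∈
      fracSubring (blowupRing (realR p S f g x hθ m) (ξ : AdjoinRoot (radPoly p S f))) (realR p S f g x hθ (m + 1)) := by
    have : theta p S f g x (m + 1) =
        (theta p S f g x m - emb p S f m (g m)) / (ξ : AdjoinRoot (radPoly p S f)) * emb p S f (m + 1) s'' := by
      rw [hθdiv, mul_assoc, mul_comm (theta p S f g x (m + 1)), ← mul_assoc, ← map_mul, hss, map_one, one_mul]
    rw [this]
    refine mul_mem (le_fracSubring _ _ ?_) (hS s'')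
    exact div_mem_blowupRing (R := realR p S f g x hθ m) _
      (theta_sub_mem_maximalIdeal_realR p S f g x hθ m (hinj m) hfg)
  have hFr : realR p S f g x hθ (m + 1) ≤
      fracSubring (blowupRing (realR p S f g x hθ m) (ξ : AdjoinRoot (radPoly p S f))) (realR p S f g x hθ (m + 1)) :=
    lift_range_le _ _ hS hθ'
  -- (c) domination: `𝔑_m ⊆ 𝔑_{m+1}`
  have hle𝔪 : maximalIdeal (realR p S f g x hθ m) ≤
      (maximalIdeal (realR p S f g x hθ (m + 1))).comap (Subring.inclusion hRR) := by
    refine maximalIdeal_realR_le p S f g x hθ m (hinj m) hfg ?_ ?_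
    · rw [Ideal.mem_comap]
      have : Subring.inclusion hRR ⟨theta p S f g x m - emb p S f m (g m), sub_mem (theta_mem_realR p S f g x hθ m)
          (emb_mem_realR p S f g x hθ m (g m))⟩ =
          (⟨emb p S f (m + 1) (x m), emb_mem_realR p S f g x hθ (m + 1) (x m)⟩ : realR p S f g x hθ (m + 1)) *
            ⟨theta p S f g x (m + 1), theta_mem_realR p S f g x hθ (m + 1)⟩ :=
        Subtype.ext (by simp [hθsub])
      rw [this]
      exact Ideal.mul_mem_right _ _ (emb_mem_maximalIdeal_realR p S f g x hθ (m + 1) (hinj (m + 1)) hxm𝔪)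
    · intro s hs
      rw [Ideal.mem_comap]
      have : Subring.inclusion hRR ⟨emb p S f m s, emb_mem_realR p S f g x hθ m s⟩ =
          (⟨emb p S f (m + 1) ⟨(s : L), hle m s.2⟩, emb_mem_realR p S f g x hθ (m + 1) _⟩ :
            realR p S f g x hθ (m + 1)) :=
        Subtype.ext (emb_eq_of_coe_eq p S f rfl)
      rw [this]
      exact emb_mem_maximalIdeal_realR p S f g x hθ (m + 1) (hinj (m + 1))
        (NoEternalChainOne.inclusion_mem_maximalIdeal_of_subringDominates hdom hs)
  have hdomR : SubringDominates (realR p S f g x hθ m) (realR p S f g x hθ (m + 1)) := by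
    refine ⟨hRR, fun y hy hyinv => ?_⟩
    by_cases hy0 : y = 0
    · rw [hy0, inv_zero]; exact zero_mem _
    by_contra hcontra
    have hy𝔪 : (⟨y, hy⟩ : realR p S f g x hθ m) ∈ maximalIdeal (realR p S f g x hθ m) :=
      (mem_maximalIdeal_iff_inv_not_mem _).mpr (Or.inr hcontra)
    have := hle𝔪 hy𝔪
    rw [Ideal.mem_comap, mem_maximalIdeal_iff_inv_not_mem] at this
    rcases this with h | h
    · exact hy0 h
    · exact h hyinv
  exact ⟨inferInstance, ξ, hξ𝔪, fun h => hξ0 (congrArg Subtype.val h), inferInstance, hBl,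
    fun z hz => by
      obtain ⟨a, ha, b, hb, -, hbi, hab⟩ := hFr hz
      exact ⟨a, ha, b, hb, hbi, hab⟩,
    hdomR⟩

end QT

end RadicandChainRealisation

end Summit.ResolutionOfSingularities.ResolutionOfSingularities.Theorems.SwitchingDichotomy

end
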